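import Summits.BirchSwinnertonDyer.BirchSwinnertonDyer.Theorems.BiquadraticEisensteinDescentHeegnerTwistCouplingInSupplySymbolicMonskyEvenDesignDoor
import Summits.BirchSwinnertonDyer.BirchSwinnertonDyer.Theorems.BiquadraticEisensteinDescentHeegnerTwistCouplingInSupplySymbolicMonskyEvenDesignMuOne
import HarnessLib

set_option linter.dupNamespace false -- `Summit.BirchSwinnertonDyer.BirchSwinnertonDyer.Theorems.…` (summit = sub)
set_option autoImplicit false

/-!
# Crux `HeegnerTwistCouplingInSupply` (stmt-BirchSwinnertonDyer-21381) — EVEN bases with NO prime `≡ 7 (mod 8)`: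
# at `δ = 1` the `0 × V` section of the even pencil never obstructs (conjecture (★) on the class family `{1, 3, 5} (mod 8)`)

Route `BiquadraticEisensteinDescent` (cell `pub/bsd-wall`, width seat `bsd-wall-cm-bed-w3` g25; `--supports` 21381, helper). Companion of
`…SymbolicMonskyEvenDesignMuOne` (p756294: one prime `≡ 3 (mod 4)`) and `…SymbolicMonskyEvenDesignNegTwoOne` (p756989: one prime `≡ ±3 (mod 8)`).
Setting of `…SymbolicMonskyEvenKernelParity` (p751399): for an even root-number-`−1` base `E_{2·P₀⋯P_k}` (an odd number of `P_b ≡ 3 (mod 4)`, `hμ`)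
EVEN THEOREM A (`exists_patternFree_even_design_pencil_of_odd`) turns a `(2/·)`-vector `δ` whose even pencil `W_ev(δ)` meets `V × 0`, `0 × V`
and the diagonal in dimension `≤ τ₀ = (dim 𝒦_ev + 1)/2` into a pattern-free Heegner recipe with `τ₀ + 1` auxiliary primes. Conjecture (★) of memo
EVEN-EXCEPTIONAL-CLASS-w3g24 §2b: at `δ = 1` the `0 × V` condition ALWAYS holds. This file proves (★) on the family of bases WITHOUT a prime
`≡ 7 (mod 8)` (every `P_b ≡ 3 (mod 4)` is `≡ 3 (mod 8)`, i.e. `[(-1/P_b) = −1] → [(2/P_b) = −1]`; classes `1, 3, 5 (mod 8)` arbitrary otherwise).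
This family contains the two-class families `{1,3}` (`…EvenDesignClassesOneThree`) and `{3,5}` (`…EvenDesignClassesThreeFive`) and, by the
exhaustive censuses of memo EVEN-EXCEPTIONAL-CLASS-w3g24 §0/§2e, EVERY «vertical» exceptional base with `K ≤ 6` (class multisets `{3,5⁴}`,
`{1,3,5⁴}`, `{1,5⁴,7}`… — the last one excepted).
* `swap_mem_evenPencil_one_inf_ker_snd_of_noSeven` — MECHANISM: if `(0, u) ∈ W_ev(1)` with `⟨m,u⟩ = ⟨d,u⟩ = 0` then `(u, 0) ∈ W_ev(1)`. Indeed
  `(0,u) ∈ W_ev(1)` means `(u, γ·1) ∈ 𝒦_ev` for some `γ ∈ 𝔽₂`; summing the first even kernel equations over all indices (column sums of the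
  Laplacian vanish for odd μ, `sum_lap_eq_one_add_mu_mul`) gives `γ = ⟨m,u⟩ + ⟨d,u⟩ = 0`, then the second equations give `u|_D = 0` and the first
  `Lu = 0`; with no prime `≡ 7 (mod 8)` (`M ⊆ D`) also `u|_M = 0`, and `(0, u) ∈ 𝒦_ev`, i.e. `(u, 0) = T_1(0,u) ∈ W_ev(1)`.
* ★★ `two_mul_finrank_evenPencil_one_inf_ker_fst_le_of_noSeven` — hence `2 · dim (W_ev(1) ∩ 0×V) ≤ dim 𝒦_ev + 1 = 2τ₀`: the swap embeds the
  codimension-`≤ 2` subspace `{⟨m,u⟩ = ⟨d,u⟩ = 0}` of the `0 × V` section into the `V × 0` section, MISSING the element `(1, 0)` of the latter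
  (`⟨m,1⟩ = μ = 1`); the two sections are disjoint inside `W_ev(1)` (dimension `dim 𝒦_ev + 1`), so `2·dim (W_ev(1) ∩ 0×V) ≤ dim 𝒦_ev + 2`, and the
  kernel parity `odd_finrank_evenVirtualKernel` removes the last unit. Condition (h2) of EVEN THEOREM A therefore holds at `δ = 1` on the family.
* ★★★ `exists_patternFree_even_design_one_of_noSeven` — two-condition door at `δ = 1` (`V × 0` and diagonal sections `≤ τ₀` ⇒ pattern-free Heegner
  recipe with `τ₀ + 1` auxiliary primes), and ★★★ `exists_recipe_cruxOn_even_one_of_noSeven` — the same through the realisation door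
  `RealisesK.cruxOn_even_of_BT_of_forall` (conclusion of `HeegnerTwistCouplingInSupply` at `(E_{2n}, P₀)` for realising primes in the size window,
  modulo Burungale–Tian). Both remaining conditions are genuine: the `K = 5` base `(3,5,5,5,5)` of `even_universality_fails` (p750799) is in the family.
HONEST FRAMING: RUNG-LEVEL corner layer (even congruent `j = 1728` families `E_{2n₀}`); `𝔽₂`-linear algebra attached to Monsky matrices
[cite: HeathBrown1994SelmerCongruentII, Appendix (Monsky), typescript p. 41 L20–L36]; instances need located primes (w4 layer) and the print input
[cite: BurungaleTian2026, Thm. 1.1]; the crux as stated (C⁺), its registered stubs and BSD are NOT touched; nothing is closed. THEOREMS ONLY.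
-/

namespace Summit.BirchSwinnertonDyer.BirchSwinnertonDyer.Theorems.SymbolicMonsky

section NoSevenEven

open Module Matrix Literature.NumberTheory.EllipticCurves Literature.NumberTheory.EllipticCurves.HeathBrown1994
  Literature.NumberTheory.EllipticCurves.HeathBrown1994.Families
open Literature.NumberTheory.EllipticCurves.Rank1Residual

variable {k : ℕ} (base : SymbData (k + 1))

/-- Column sums of the Laplacian: `Σ_i Σ_j [(P_j/P_i) = −1](y_j + y_i) = (1 + μ)⟨m,y⟩` (quadratic reciprocity `bz_neg_swap`). [folklore] -/
private theorem sum_lap_eq_one_add_mu_mul (y : Fin (k + 1) → ZMod 2) :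
    (∑ i, ∑ j, bz (base.neg i j) * (y j + y i)) =
      (1 + ∑ b, bz (negNegOne (base.cls b))) * ∑ j, bz (negNegOne (base.cls j)) * y j := by
  have h2 : ∀ x : ZMod 2, x + x = 0 := by decide
  have hsq : ∀ x : ZMod 2, x * x = x := by decide
  have e1 : (∑ i, ∑ j, bz (base.neg i j) * (y j + y i)) = ∑ i, ∑ j, (bz (base.neg j i) + bz (base.neg i j)) * y i := by
    have : (∑ i, ∑ j, bz (base.neg i j) * (y j + y i)) = (∑ i, ∑ j, bz (base.neg i j) * y j) + ∑ i, ∑ j, bz (base.neg i j) * y i := by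
      rw [← Finset.sum_add_distrib]
      refine Finset.sum_congr rfl fun i _ => ?_
      rw [← Finset.sum_add_distrib]
      exact Finset.sum_congr rfl fun j _ => by ring
    rw [this, Finset.sum_comm, ← Finset.sum_add_distrib]
    refine Finset.sum_congr rfl fun i _ => ?_
    rw [← Finset.sum_add_distrib]
    exact Finset.sum_congr rfl fun j _ => by ring
  have e2 : ∀ i, (∑ j, (bz (base.neg j i) + bz (base.neg i j)) * y i) =
      (∑ j, bz (negNegOne (base.cls i)) * bz (negNegOne (base.cls j)) * y i) + bz (negNegOne (base.cls i)) * y i := by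
    intro i
    have hpt : ∀ j, (bz (base.neg j i) + bz (base.neg i j)) * y i =
        bz (negNegOne (base.cls i)) * bz (negNegOne (base.cls j)) * y i + (if j = i then bz (negNegOne (base.cls i)) * y i else 0) := by
      intro j
      by_cases hji : j = i
      · subst hji
        rw [if_pos rfl]
        linear_combination (h2 (bz (base.neg j j))) * y j - (hsq (bz (negNegOne (base.cls j)))) * y j -
          h2 (bz (negNegOne (base.cls j)) * y j)
      · have hij : i ≠ j := fun h => hji h.symm
        rw [if_neg hji, base.bz_neg_swap hij, bz_and_mul]
        linear_combination (h2 (bz (base.neg i j))) * y i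
    rw [Finset.sum_congr rfl fun j _ => hpt j, Finset.sum_add_distrib, Finset.sum_ite_eq' Finset.univ i]
    simp only [Finset.mem_univ, if_true]
  rw [e1, Finset.sum_congr rfl fun i _ => e2 i, Finset.sum_add_distrib, add_mul, one_mul, Finset.mul_sum]
  have e3 : ∀ i, (∑ j, bz (negNegOne (base.cls i)) * bz (negNegOne (base.cls j)) * y i) =
      (∑ b, bz (negNegOne (base.cls b))) * (bz (negNegOne (base.cls i)) * y i) := by
    intro i
    rw [Finset.sum_mul]
    exact Finset.sum_congr rfl fun j _ => by ring
  rw [Finset.sum_congr rfl fun i _ => e3 i, add_comm]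

/-- An even root-number-`−1` base (`Σ_b [P_b ≡ 3 (4)] = 1` in `𝔽₂`) has some prime `≡ 3 (mod 4)`. -/
private theorem exists_negNegOne_of_sum_eq_one (hμ : (∑ b, bz (negNegOne (base.cls b))) = 1) :
    ∃ b₀, negNegOne (base.cls b₀) = true := by
  obtain ⟨b₀, -, hb₀⟩ := Finset.exists_ne_zero_of_sum_ne_zero
    (by rw [hμ]; exact one_ne_zero : (∑ b, bz (negNegOne (base.cls b))) ≠ 0)
  refine ⟨b₀, ?_⟩
  cases h : negNegOne (base.cls b₀) with
  | true => rfl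
  | false => rw [h] at hb₀; exact absurd (by decide : bz false = 0) hb₀

/-- Cutting a subspace by one linear functional costs at most one dimension. -/
private theorem finrank_le_finrank_inf_ker_add_one {Z : Type*} [AddCommGroup Z] [Module (ZMod 2) Z] [FiniteDimensional (ZMod 2) Z]
    (C : Submodule (ZMod 2) Z) (f : Z →ₗ[ZMod 2] ZMod 2) :
    finrank (ZMod 2) ↥C ≤ finrank (ZMod 2) ↥(C ⊓ LinearMap.ker f) + 1 := by
  have h1 := Submodule.finrank_sup_add_finrank_inf_eq C (LinearMap.ker f)
  have h2 := LinearMap.finrank_range_add_finrank_ker f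
  have h3 : finrank (ZMod 2) ↥(LinearMap.range f) ≤ 1 := by
    have := Submodule.finrank_le (LinearMap.range f)
    rwa [Module.finrank_self] at this
  have h4 : finrank (ZMod 2) ↥(C ⊔ LinearMap.ker f) ≤ finrank (ZMod 2) Z := Submodule.finrank_le _
  omega

/-- Elements of the even pencil at `δ = 1`: `(v + γ·1, u)` for an even kernel pair `(u, v)` and `γ ∈ 𝔽₂`. -/
private theorem mem_evenPencil_one_iff (p : (Fin (k + 1) → ZMod 2) × (Fin (k + 1) → ZMod 2)) :
    p ∈ base.evenPencil (fun _ => 1) ↔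
      ∃ (u v : Fin (k + 1) → ZMod 2) (γ : ZMod 2), (u, v) ∈ base.evenVirtualKernel ∧ p = (fun b => v b + γ, u) := by
  have h11 : (1 : ZMod 2) + 1 = 0 := by decide
  rw [mem_evenPencil_iff]
  constructor
  · rintro ⟨u, v, γ, hE1, hE2, rfl⟩
    refine ⟨u, v, γ, (mem_evenVirtualKernel_iff base (u, v)).2 ⟨hE1, hE2⟩, Prod.ext ?_ ?_⟩
    · funext b; simp [h11]
    · funext b; simp [h11]
  · rintro ⟨u, v, γ, huv, rfl⟩
    obtain ⟨hE1, hE2⟩ := (mem_evenVirtualKernel_iff base (u, v)).1 huv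
    refine ⟨u, v, γ, hE1, hE2, Prod.ext ?_ ?_⟩
    · funext b; simp [h11]
    · funext b; simp [h11]

/-- **MECHANISM (no prime `≡ 7 (mod 8)`).** If `(0, u)` lies in the even pencil at `δ = 1` and `⟨m,u⟩ = ⟨d,u⟩ = 0`, then `(u, 0)` lies in it
too. (`(0,u) ∈ W_ev(1)` means `(u, γ·1) ∈ 𝒦_ev`; the column sums of the first kernel equations give `γ = ⟨m,u⟩ + ⟨d,u⟩ = 0`, then `u|_D = 0`,
`Lu = 0`, and — as every prime `≡ 3 (mod 4)` is `≡ 3 (mod 8)` — `u|_M = 0`, so `(0, u) ∈ 𝒦_ev` and `(u, 0) = T_1(0, u)`.)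
[cite: HeathBrown1994SelmerCongruentII, Appendix (Monsky), typescript p. 41 L20–L36] -/
theorem swap_mem_evenPencil_one_inf_ker_snd_of_noSeven
    (h7 : ∀ b, negNegOne (base.cls b) = true → negTwo (base.cls b) = true) (hμ : (∑ b, bz (negNegOne (base.cls b))) = 1)
    (p : (Fin (k + 1) → ZMod 2) × (Fin (k + 1) → ZMod 2))
    (hp : p ∈ base.evenPencil (fun _ => 1) ⊓ LinearMap.ker (LinearMap.fst (ZMod 2) (Fin (k + 1) → ZMod 2) (Fin (k + 1) → ZMod 2)))
    (hm : (∑ b, bz (negNegOne (base.cls b)) * p.2 b) = 0) (hd : (∑ b, bz (negTwo (base.cls b)) * p.2 b) = 0) :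
    ((p.2, 0) : (Fin (k + 1) → ZMod 2) × (Fin (k + 1) → ZMod 2)) ∈
      base.evenPencil (fun _ => 1) ⊓ LinearMap.ker (LinearMap.snd (ZMod 2) (Fin (k + 1) → ZMod 2) (Fin (k + 1) → ZMod 2)) := by
  have h2 : ∀ x : ZMod 2, x + x = 0 := by decide
  obtain ⟨hpW, hp0⟩ := Submodule.mem_inf.1 hp
  obtain ⟨u, v, γ, huv, rfl⟩ := (mem_evenPencil_one_iff base p).1 hpW
  rw [LinearMap.mem_ker, LinearMap.fst_apply] at hp0
  have hv : ∀ b, v b = γ := fun b => by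
    have := congrFun hp0 b
    simp only [Pi.zero_apply] at this
    linear_combination this - h2 γ
  simp only at hm hd
  obtain ⟨hE1, hE2⟩ := (mem_evenVirtualKernel_iff base (u, v)).1 huv
  -- the two kernel equations of `(u, γ·1)` with `⟨m,u⟩ = 0`
  have e1 : ∀ i, (∑ j, bz (base.neg i j) * (u j + u i)) + bz (negTwo (base.cls i)) * u i + bz (negNegOne (base.cls i)) * γ = 0 :=
    fun i => by
    have e := hE1 i
    simp only [hm, hv, mul_zero, add_zero] at e
    exact e
  have e2 : ∀ i, bz (negTwo (base.cls i)) * u i + bz (negNegOne (base.cls i)) * γ + bz (negTwo (base.cls i)) * γ = 0 := fun i => by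
    have e := hE2 i
    simp only [hm, hv, mul_zero, add_zero, lap_const] at e
    linear_combination e
  -- column sums: `γ = ⟨d,u⟩ = 0`
  have hγ : γ = 0 := by
    have hs : (∑ i, ((∑ j, bz (base.neg i j) * (u j + u i)) + bz (negTwo (base.cls i)) * u i + bz (negNegOne (base.cls i)) * γ)) = 0 :=
      Finset.sum_eq_zero fun i _ => e1 i
    rw [Finset.sum_add_distrib, Finset.sum_add_distrib, sum_lap_eq_one_add_mu_mul base u, hm, hd, ← Finset.sum_mul, hμ] at hs
    linear_combination hs
  have hdu : ∀ i, bz (negTwo (base.cls i)) * u i = 0 := fun i => by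
    have e := e2 i
    rw [hγ, mul_zero, mul_zero, add_zero, add_zero] at e
    exact e
  have hlap : ∀ i, (∑ j, bz (base.neg i j) * (u j + u i)) = 0 := fun i => by
    have e := e1 i
    rw [hγ, hdu i, mul_zero, add_zero, add_zero] at e
    exact e
  -- no prime `≡ 7 (mod 8)`: `u|_M = 0`
  have hmu : ∀ i, bz (negNegOne (base.cls i)) * u i = 0 := fun i => by
    cases hi : negNegOne (base.cls i) with
    | false => exact zero_mul _
    | true =>
      have := hdu i
      rw [h7 i hi] at this
      exact this
  -- `(0, u) ∈ 𝒦_ev`, so `(u, 0) ∈ W_ev(1)`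
  have h0u : ((0 : Fin (k + 1) → ZMod 2), u) ∈ base.evenVirtualKernel := by
    rw [mem_evenVirtualKernel_iff]
    refine ⟨fun i => ?_, fun i => ?_⟩
    · simp only [Pi.zero_apply, add_zero, mul_zero, Finset.sum_const_zero, zero_add]
      exact hmu i
    · simp only [Pi.zero_apply, mul_zero, Finset.sum_const_zero, zero_add, add_zero]
      linear_combination hlap i + hmu i + hdu i
  refine Submodule.mem_inf.2 ⟨?_, by rw [LinearMap.mem_ker, LinearMap.snd_apply]⟩
  rw [mem_evenPencil_one_iff]
  exact ⟨0, u, 0, h0u, Prod.ext (funext fun b => by simp) rfl⟩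

/-- ★★ **(★) for bases with no prime `≡ 7 (mod 8)`, dimension form**: `2 · dim (W_ev(1) ∩ 0×V) ≤ dim 𝒦_ev + 1` (`= 2τ₀` by the kernel
parity). The swap `(0,u) ↦ (u,0)` embeds the codimension-`≤ 2` part `{⟨m,u⟩ = ⟨d,u⟩ = 0}` of the `0 × V` section into the `V × 0` section and
misses its element `(1, 0)`; the two sections are disjoint in `W_ev(1)` (dimension `dim 𝒦_ev + 1`), and `dim 𝒦_ev` is odd.
[cite: HeathBrown1994SelmerCongruentII, Appendix (Monsky), typescript p. 41 L20–L36] -/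
theorem two_mul_finrank_evenPencil_one_inf_ker_fst_le_of_noSeven
    (h7 : ∀ b, negNegOne (base.cls b) = true → negTwo (base.cls b) = true) (hμ : (∑ b, bz (negNegOne (base.cls b))) = 1) :
    2 * finrank (ZMod 2) ↥(base.evenPencil (fun _ => 1) ⊓
        LinearMap.ker (LinearMap.fst (ZMod 2) (Fin (k + 1) → ZMod 2) (Fin (k + 1) → ZMod 2))) ≤
      finrank (ZMod 2) ↥base.evenVirtualKernel + 1 := by
  obtain ⟨b₀, hb₀⟩ := exists_negNegOne_of_sum_eq_one base hμ
  set W := base.evenPencil (fun _ => 1) with hWdef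
  set C := W ⊓ LinearMap.ker (LinearMap.fst (ZMod 2) (Fin (k + 1) → ZMod 2) (Fin (k + 1) → ZMod 2)) with hC
  set A := W ⊓ LinearMap.ker (LinearMap.snd (ZMod 2) (Fin (k + 1) → ZMod 2) (Fin (k + 1) → ZMod 2)) with hA
  -- the two linear conditions `⟨m, p.2⟩ = 0`, `⟨d, p.2⟩ = 0`
  obtain ⟨φm, hφm⟩ := exists_dot_dual (k := k) (fun b => bz (negNegOne (base.cls b)))
  obtain ⟨φd, hφd⟩ := exists_dot_dual (k := k) (fun b => bz (negTwo (base.cls b)))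
  set fm := φm.comp (LinearMap.snd (ZMod 2) (Fin (k + 1) → ZMod 2) (Fin (k + 1) → ZMod 2)) with hfm
  set fd := φd.comp (LinearMap.snd (ZMod 2) (Fin (k + 1) → ZMod 2) (Fin (k + 1) → ZMod 2)) with hfd
  set C₀ := (C ⊓ LinearMap.ker fm) ⊓ LinearMap.ker fd with hC₀
  -- the swap
  set e := LinearEquiv.prodComm (ZMod 2) (Fin (k + 1) → ZMod 2) (Fin (k + 1) → ZMod 2) with he
  have hC₀A : C₀.map e.toLinearMap ≤ A := by
    intro q hq
    obtain ⟨p, hp, rfl⟩ := Submodule.mem_map.1 hq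
    obtain ⟨hp1, hpd⟩ := Submodule.mem_inf.1 hp
    obtain ⟨hpC, hpm⟩ := Submodule.mem_inf.1 hp1
    have hp0 : p.1 = 0 := by
      have := (Submodule.mem_inf.1 hpC).2
      rwa [LinearMap.mem_ker, LinearMap.fst_apply] at this
    have hm : (∑ b, bz (negNegOne (base.cls b)) * p.2 b) = 0 := by
      rw [LinearMap.mem_ker, hfm, LinearMap.comp_apply, LinearMap.snd_apply, hφm] at hpm
      exact hpm
    have hd : (∑ b, bz (negTwo (base.cls b)) * p.2 b) = 0 := by
      rw [LinearMap.mem_ker, hfd, LinearMap.comp_apply, LinearMap.snd_apply, hφd] at hpd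
      exact hpd
    have hsw : e.toLinearMap p = (p.2, 0) := by
      rw [LinearEquiv.coe_toLinearMap, he, LinearEquiv.prodComm_apply, Prod.swap, hp0]
    rw [hsw]
    exact swap_mem_evenPencil_one_inf_ker_snd_of_noSeven base h7 hμ p hpC hm hd
  -- `(1, 0) ∈ A` but not in the image of the swap (`⟨m, 1⟩ = μ = 1`)
  set x₁ : (Fin (k + 1) → ZMod 2) × (Fin (k + 1) → ZMod 2) := (fun _ => 1, 0) with hx₁
  have hx₁A : x₁ ∈ A := by
    refine Submodule.mem_inf.2 ⟨?_, by rw [LinearMap.mem_ker, LinearMap.snd_apply]⟩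
    rw [mem_evenPencil_one_iff]
    exact ⟨0, 0, 1, base.evenVirtualKernel.zero_mem, Prod.ext (funext fun b => by simp [hx₁]) rfl⟩
  have hx₁0 : x₁ ≠ 0 := by
    intro h
    have := congrFun (congrArg Prod.fst h) 0
    simp [hx₁] at this
  have hx₁not : x₁ ∉ C₀.map e.toLinearMap := by
    intro hx
    obtain ⟨p, hp, hpx⟩ := Submodule.mem_map.1 hx
    obtain ⟨hp1, -⟩ := Submodule.mem_inf.1 hp
    obtain ⟨-, hpm⟩ := Submodule.mem_inf.1 hp1
    rw [LinearMap.mem_ker, hfm, LinearMap.comp_apply, LinearMap.snd_apply, hφm] at hpm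
    have hp2 : p.2 = fun _ => 1 := by
      have := congrArg Prod.fst hpx
      rw [LinearEquiv.coe_toLinearMap, he, LinearEquiv.prodComm_apply] at this
      simpa [hx₁] using this
    rw [hp2] at hpm
    simp only [mul_one] at hpm
    rw [hμ] at hpm
    exact one_ne_zero hpm
  -- dimension count
  have hdis : C₀.map e.toLinearMap ⊓ Submodule.span (ZMod 2) {x₁} = ⊥ :=
    disjoint_iff.1 ((Submodule.disjoint_span_singleton' hx₁0).2 hx₁not)
  have hsum₁ := Submodule.finrank_sup_add_finrank_inf_eq (C₀.map e.toLinearMap) (Submodule.span (ZMod 2) {x₁})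
  rw [hdis, finrank_bot, add_zero, finrank_span_singleton hx₁0,
    ← LinearEquiv.finrank_eq (Submodule.equivMapOfInjective _ e.injective C₀)] at hsum₁
  have hle₁ : finrank (ZMod 2) ↥(C₀.map e.toLinearMap ⊔ Submodule.span (ZMod 2) {x₁}) ≤ finrank (ZMod 2) ↥A :=
    Submodule.finrank_mono (sup_le hC₀A ((Submodule.span_singleton_le_iff_mem _ _).2 hx₁A))
  have hcod₁ := finrank_le_finrank_inf_ker_add_one C fm
  have hcod₂ : finrank (ZMod 2) ↥(C ⊓ LinearMap.ker fm) ≤ finrank (ZMod 2) ↥C₀ + 1 :=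
    finrank_le_finrank_inf_ker_add_one (C ⊓ LinearMap.ker fm) fd
  have hCA : C ⊓ A = ⊥ := by
    rw [Submodule.eq_bot_iff]
    intro p hp
    obtain ⟨hpC, hpA⟩ := Submodule.mem_inf.1 hp
    have h1 : p.1 = 0 := by
      have := (Submodule.mem_inf.1 hpC).2
      rwa [LinearMap.mem_ker, LinearMap.fst_apply] at this
    have hp2 : p.2 = 0 := by
      have := (Submodule.mem_inf.1 hpA).2
      rwa [LinearMap.mem_ker, LinearMap.snd_apply] at this
    exact Prod.ext h1 hp2
  have hsup : C ⊔ A ≤ W := sup_le inf_le_left inf_le_left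
  have hW : finrank (ZMod 2) ↥W = finrank (ZMod 2) ↥base.evenVirtualKernel + 1 :=
    finrank_evenPencil_eq base (fun _ => 1) (evenPencil_one_legit base b₀ hb₀)
  have hsum := Submodule.finrank_sup_add_finrank_inf_eq C A
  rw [hCA, finrank_bot, add_zero] at hsum
  have hmono := Submodule.finrank_mono hsup
  obtain ⟨r, hr⟩ := odd_finrank_evenVirtualKernel base hμ
  omega

/-- ★★★ **EVEN DOOR AT δ = 1 for bases with no prime `≡ 7 (mod 8)` (two conditions).** For an even root-number-`−1` base `E_{2·P₀⋯P_k}`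
all of whose primes `≡ 3 (mod 4)` are `≡ 3 (mod 8)`, put `τ₀ := (dim 𝒦_ev + 1)/2`. If the even pencil at `δ = 1` meets `V × 0` and the diagonal
in dimension `≤ τ₀`, a pattern-free Heegner recipe with `τ₀ + 1` auxiliary primes exists (cells `c₁ :: rest`, `|rest| = τ₀`, `heegnerK`, Monsky's
even matrix invertible for EVERY mutual pattern). [cite: HeathBrown1994SelmerCongruentII, Appendix (Monsky), typescript p. 41 L20–L36] -/
theorem exists_patternFree_even_design_one_of_noSeven
    (h7 : ∀ b, negNegOne (base.cls b) = true → negTwo (base.cls b) = true) (hμ : (∑ b, bz (negNegOne (base.cls b))) = 1)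
    (h1 : finrank (ZMod 2) ↥(base.evenPencil (fun _ => 1) ⊓
      LinearMap.ker (LinearMap.snd (ZMod 2) (Fin (k + 1) → ZMod 2) (Fin (k + 1) → ZMod 2))) ≤
        (finrank (ZMod 2) ↥base.evenVirtualKernel + 1) / 2)
    (h3 : finrank (ZMod 2) ↥(base.evenPencil (fun _ => 1) ⊓
      LinearMap.ker (LinearMap.fst (ZMod 2) (Fin (k + 1) → ZMod 2) (Fin (k + 1) → ZMod 2) +
        LinearMap.snd (ZMod 2) (Fin (k + 1) → ZMod 2) (Fin (k + 1) → ZMod 2))) ≤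
        (finrank (ZMod 2) ↥base.evenVirtualKernel + 1) / 2) :
    ∃ (c₁ : AuxCell) (rest : List AuxCell), rest.length = (finrank (ZMod 2) ↥base.evenVirtualKernel + 1) / 2 ∧
      heegnerK base (c₁ :: rest) = true ∧ ∀ pat : ℕ → ℕ → Bool, (dataK base (c₁ :: rest) pat).monskyEvenS.det = 1 := by
  obtain ⟨b₀, hb₀⟩ := exists_negNegOne_of_sum_eq_one base hμ
  obtain ⟨r, hr⟩ := odd_finrank_evenVirtualKernel base hμ
  have h2 : finrank (ZMod 2) ↥(base.evenPencil (fun _ => 1) ⊓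
      LinearMap.ker (LinearMap.fst (ZMod 2) (Fin (k + 1) → ZMod 2) (Fin (k + 1) → ZMod 2))) ≤
        (finrank (ZMod 2) ↥base.evenVirtualKernel + 1) / 2 := by
    have := two_mul_finrank_evenPencil_one_inf_ker_fst_le_of_noSeven base h7 hμ
    omega
  exact exists_patternFree_even_design_pencil_of_odd base hμ (fun _ => 1) (evenPencil_one_legit base b₀ hb₀) h1 h2 h3

/-- ★★★ **The same through the realisation door**: for every even root-number-`−1` base with no prime `≡ 7 (mod 8)` whose even pencil at
`δ = 1` meets `V × 0` and the diagonal in dimension `≤ τ₀^{ev}`, one cell list `aux` (`τ₀^{ev} + 1` cells, `heegnerK`) such that any realising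
primes in the size window give the conclusion of `HeegnerTwistCouplingInSupply` at `(E_{2n}, P₀)`, modulo Burungale–Tian.
[cite: HeathBrown1994SelmerCongruentII, Appendix (Monsky), typescript p. 41 L20–L36] [cite: BurungaleTian2026, Thm. 1.1]
[cite: Oesterle1988Gauss, II §3 Proposition p. 57 (27)] -/
theorem exists_recipe_cruxOn_even_one_of_noSeven (hBT : burungaleTian_analyticRank_eq_zero_of_selmerCorank_eq_zero_of_hasCM)
    (h7 : ∀ b, negNegOne (base.cls b) = true → negTwo (base.cls b) = true) (hμ : (∑ b, bz (negNegOne (base.cls b))) = 1)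
    (h1 : finrank (ZMod 2) ↥(base.evenPencil (fun _ => 1) ⊓
      LinearMap.ker (LinearMap.snd (ZMod 2) (Fin (k + 1) → ZMod 2) (Fin (k + 1) → ZMod 2))) ≤
        (finrank (ZMod 2) ↥base.evenVirtualKernel + 1) / 2)
    (h3 : finrank (ZMod 2) ↥(base.evenPencil (fun _ => 1) ⊓
      LinearMap.ker (LinearMap.fst (ZMod 2) (Fin (k + 1) → ZMod 2) (Fin (k + 1) → ZMod 2) +
        LinearMap.snd (ZMod 2) (Fin (k + 1) → ZMod 2) (Fin (k + 1) → ZMod 2))) ≤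
        (finrank (ZMod 2) ↥base.evenVirtualKernel + 1) / 2) :
    ∃ aux : List AuxCell, aux.length = (finrank (ZMod 2) ↥base.evenVirtualKernel + 1) / 2 + 1 ∧ heegnerK base aux = true ∧
      ∀ (P : Fin (k + 1) → ℕ) (q : Fin aux.length → ℕ), RealisesK base aux P q →
        ∀ (n : ℕ) [(congruentNumberCurve (2 * n)).IsElliptic], (∏ b, P b) = n →
          Real.sqrt ((∏ j, q j : ℕ) : ℝ) * Real.log ((∏ j, q j : ℕ) : ℝ) < Real.pi * P 0 →
          ∃ (K : Type) (_ : Field K) (_ : NumberField K),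
            IsImaginaryQuadratic K ∧ 4 < (NumberField.discr K).natAbs ∧
            SatisfiesHeegnerHypothesis ((congruentNumberCurve (2 * n)).conductorNorm ℤ) K ∧
            ((congruentNumberCurve (2 * n)).quadraticTwist (NumberField.discr K : ℚ)).entireLFunction 1 ≠ 0 ∧
            ¬ P 0 ∣ NumberField.classNumber K := by
  obtain ⟨c₁, rest, hlen, hH, hdet⟩ := exists_patternFree_even_design_one_of_noSeven base h7 hμ h1 h3
  refine ⟨c₁ :: rest, by simp [hlen], hH, ?_⟩
  intro P q hR n _ hn hsize
  exact hR.cruxOn_even_of_BT_of_forall hBT hH hdet hn hsize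

end NoSevenEven

end Summit.BirchSwinnertonDyer.BirchSwinnertonDyer.Theorems.SymbolicMonsky
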